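import Summits.QuantumFields.YangMills.Theorems.FlatTubeReductionDressedClusterAbsorption
import Summits.QuantumFields.YangMills.Theorems.LuscherReductionRunningReductionInnerCopies
import Summits.QuantumFields.YangMills.Theorems.LuscherReductionRunningReductionCoarseUpperCopies
import Summits.QuantumFields.YangMills.Theorems.FemtoTransferGapSlabGround
import HarnessLib

/-!
# The eight-copy WINDOW of the dressed one-site no-intruder: the symmetrised window indicator, twist averaging of second-moment weights, and the two dressed moment forms
# `V` (on the cluster span) and `w` (overlaps) from one-orbit eigenfunction second moments
# (route `FlatTubeReduction`, crux K1 `NearFlatRatioLaw` stmt-QuantumFields-24720; seat `ym-line-ftr-p1` g10; R2b1 RECORD rung — no summit statement is proved here)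

Bookkeeping between the ONE-ORBIT data of the rate twin (amplitudes supported in `{orbitDist < δ}`, weight bound `|W² − 1| ≤ κ_W·orbitDist²` there, eigenfunction second
moments `∫_{orbitDist<1/2} orbitDist²·e² ≤ M`) and the PHYSICAL (twist-invariant) data that the cluster-absorption lemma `qform_dressed_le_of_cluster` (p657808) consumes
(window `S` = union of the eight twisted copies, moment forms on `S`):
* `twistWindow` facts: `Θ_δ := twistSum 𝟙{orbitDist < δ}` is physical and `Θ_δ u ≠ 0 ↔ ∃ z, orbitDist(τ_z u) < δ` (`twistWindow_ne_zero_iff`); the set `{Θ_δ ≠ 0}` is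
  measurable, gauge- and twist-invariant;
* `integral_sum_twist_mul_sq` — `∫ (Σ_z D(τ_z u))·f(u)² = 8 ∫ D·f²` for physical `f` (twist invariance of `f` and of the a-priori measure);
* `integral_weight_combination_sq_le` — `∫ D·(Σ cᵢeᵢ)² ≤ (n+1)·M·Σcᵢ²` from `∫ D·eᵢ² ≤ M` (`D ≥ 0`; pointwise Cauchy–Schwarz);
* ★ `dressed_moment_form_le` — the `V`-hypothesis of the absorption lemma: `∫ 𝟙_S|W²−1|·(Σcᵢeᵢ)² ≤ 8κ_W(n+1)M·Σcᵢ²`;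
* ★ `dressed_overlap_le` — the `w`-hypothesis: `Σᵢ ‖𝟙_S(W−1)eᵢ‖² ≤ (n+1)·κ_Wδ²·8κ_W(n+1)M` (`W ≥ 0`).
HONEST FRAMING: fixed-lattice measure bookkeeping (any `L`); the analytic input (the moments `M = Sλ_b²`, sub-target `OneSiteEigenMoments`) stays OPEN; femto rung R2b1; not a gap,
not Clay.  No defs (the window is a local abbreviation), no named facts, no `sorry`.
-/

set_option autoImplicit false

noncomputable section

open MeasureTheory Filter Topology Real
open scoped BigOperators
open Literature.MathematicalPhysics.QuantumFieldTheory
open Literature.MathematicalPhysics.QuantumLattice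

namespace Summit.QuantumFields.YangMills.Theorems.FemtoTransferGap.RateTube

open Summit.QuantumFields.YangMills.Theorems.FemtoTransferGap

variable {L : ℕ} [NeZero L]

/-! ## §1 The symmetrised window -/

/-- The one-orbit window indicator `𝟙{orbitDist < δ}` is measurable, bounded by `1`, nonnegative and gauge invariant. [folklore] -/
theorem windowIndicator_props (δ : ℝ) :
    Measurable (fun v : GaugeConfig 3 L SU2 => if orbitDist v < δ then (1 : ℝ) else 0) ∧
    (∀ v : GaugeConfig 3 L SU2, |(if orbitDist v < δ then (1 : ℝ) else 0)| ≤ 1) ∧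
    (∀ v : GaugeConfig 3 L SU2, 0 ≤ (if orbitDist v < δ then (1 : ℝ) else 0)) ∧
    (∀ (g : Site 3 L → SU2) (v : GaugeConfig 3 L SU2),
      (if orbitDist (gaugeTransform g v) < δ then (1 : ℝ) else 0) = if orbitDist v < δ then (1 : ℝ) else 0) := by
  refine ⟨Measurable.ite (measurableSet_lt measurable_orbitDist measurable_const) measurable_const measurable_const,
    fun v => ?_, fun v => ?_, fun g v => by rw [orbitDist_gaugeTransform]⟩
  · split_ifs <;> simp
  · split_ifs <;> simp

/-- ★ `Θ_δ := twistSum 𝟙{orbitDist < δ}` is a physical test function. [folklore] -/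
theorem isPhys_twistWindow (δ : ℝ) : IsPhys (twistSum (L := L) fun v => if orbitDist v < δ then (1 : ℝ) else 0) :=
  isPhys_twistSum (windowIndicator_props δ).1 ⟨1, (windowIndicator_props δ).2.1⟩ (windowIndicator_props δ).2.2.2

/-- ★ `Θ_δ u ≠ 0 ↔ ∃ z, orbitDist(τ_z u) < δ` (a sum of nonnegative indicators). [folklore] -/
theorem twistWindow_ne_zero_iff (δ : ℝ) (u : GaugeConfig 3 L SU2) :
    twistSum (fun v => if orbitDist v < δ then (1 : ℝ) else 0) u ≠ 0 ↔ ∃ z : Fin 3 → Bool, orbitDist (TT.twist3 z u) < δ := by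
  unfold twistSum
  constructor
  · intro h
    obtain ⟨z, -, hz⟩ := Finset.exists_ne_zero_of_sum_ne_zero h
    refine ⟨z, ?_⟩
    by_contra hlt
    exact hz (by simp [hlt])
  · rintro ⟨z, hz⟩
    have h1 : (1 : ℝ) ≤ ∑ z' : Fin 3 → Bool, (if orbitDist (TT.twist3 z' u) < δ then (1 : ℝ) else 0) := by
      have := Finset.single_le_sum (f := fun z' : Fin 3 → Bool => if orbitDist (TT.twist3 z' u) < δ then (1 : ℝ) else 0)
        (fun z' _ => by positivity) (Finset.mem_univ z)
      simpa [hz] using this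
    linarith

/-- The symmetrised window `S_δ = {Θ_δ ≠ 0}` is measurable, gauge invariant and twist invariant. [folklore] -/
theorem twistWindow_set_props (δ : ℝ) :
    MeasurableSet {u : GaugeConfig 3 L SU2 | twistSum (fun v => if orbitDist v < δ then (1 : ℝ) else 0) u ≠ 0} ∧
    (∀ (g : Site 3 L → SU2) (u : GaugeConfig 3 L SU2),
      gaugeTransform g u ∈ {u : GaugeConfig 3 L SU2 | twistSum (fun v => if orbitDist v < δ then (1 : ℝ) else 0) u ≠ 0} ↔
        u ∈ {u : GaugeConfig 3 L SU2 | twistSum (fun v => if orbitDist v < δ then (1 : ℝ) else 0) u ≠ 0}) ∧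
    (∀ (j : Fin 3), ∀ z ∈ Subgroup.center SU2, ∀ u : GaugeConfig 3 L SU2,
      twist j z u ∈ {u : GaugeConfig 3 L SU2 | twistSum (fun v => if orbitDist v < δ then (1 : ℝ) else 0) u ≠ 0} ↔
        u ∈ {u : GaugeConfig 3 L SU2 | twistSum (fun v => if orbitDist v < δ then (1 : ℝ) else 0) u ≠ 0}) := by
  have hΘ := isPhys_twistWindow (L := L) δ
  refine ⟨hΘ.measurable (measurableSet_singleton (0 : ℝ)).compl, fun g u => ?_, fun j z hz u => ?_⟩
  · simp only [Set.mem_setOf_eq, hΘ.gaugeInv g u]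
  · simp only [Set.mem_setOf_eq, hΘ.zeroFlux j z hz u]

/-! ## §2 Twist averaging of a weight against a physical square -/

/-- ★ `∫ (Σ_z D(τ_z u))·f(u)² du = 8·∫ D(u)·f(u)² du` for `D` bounded measurable and `f` physical (`f ∘ τ_z = f`; `τ_z` preserves the a-priori measure). [folklore] -/
theorem integral_sum_twist_mul_sq {D : GaugeConfig 3 L SU2 → ℝ} (hDm : Measurable D) {CD : ℝ} (hDb : ∀ u, |D u| ≤ CD)
    {f : GaugeConfig 3 L SU2 → ℝ} (hf : IsPhys f) :
    ∫ u, (∑ z : Fin 3 → Bool, D (TT.twist3 z u)) * f u ^ 2 ∂configMeasure SU2 L = 8 * ∫ u, D u * f u ^ 2 ∂configMeasure SU2 L := by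
  obtain ⟨Cf, hCf⟩ := hf.bounded
  have hCD : 0 ≤ CD := (abs_nonneg _).trans (hDb 1)
  have hint : ∀ z : Fin 3 → Bool, Integrable (fun u => D (TT.twist3 z u) * f u ^ 2) (configMeasure SU2 L) := fun z =>
    integrable_of_measurable_abs_le _ ((hDm.comp (TT.measurable_twist3 z)).mul (hf.measurable.pow_const 2)) (C := CD * Cf ^ 2) fun u => by
      rw [abs_mul, abs_pow]; exact mul_le_mul (hDb _) (pow_le_pow_left₀ (abs_nonneg _) (hCf u) 2) (by positivity) hCD
  have hz : ∀ z : Fin 3 → Bool, ∫ u, D (TT.twist3 z u) * f u ^ 2 ∂configMeasure SU2 L = ∫ u, D u * f u ^ 2 ∂configMeasure SU2 L := by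
    intro z
    have e1 : (fun u => D (TT.twist3 z u) * f u ^ 2) = fun u => (fun v => D v * f v ^ 2) (TT.twist3 z u) := by
      funext u; simp only [TT.twist3_eq_of_isPhys hf z u]
    rw [e1]
    exact integral_comp_eq_of_measurePreserving (TT.measurePreserving_twist3 z) (hDm.mul (hf.measurable.pow_const 2))
  calc ∫ u, (∑ z : Fin 3 → Bool, D (TT.twist3 z u)) * f u ^ 2 ∂configMeasure SU2 L
      = ∫ u, ∑ z : Fin 3 → Bool, D (TT.twist3 z u) * f u ^ 2 ∂configMeasure SU2 L := by
        refine integral_congr_ae (ae_of_all _ fun u => ?_); simp only [Finset.sum_mul]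
    _ = ∑ z : Fin 3 → Bool, ∫ u, D (TT.twist3 z u) * f u ^ 2 ∂configMeasure SU2 L := integral_finsetSum _ fun z _ => hint z
    _ = 8 * ∫ u, D u * f u ^ 2 ∂configMeasure SU2 L := by simp_rw [hz]; simp

/-- `∫ D·(Σ cᵢeᵢ)² ≤ (n+1)·M·Σ cᵢ²` for `D ≥ 0` bounded measurable and physical `eᵢ` with `∫ D·eᵢ² ≤ M` (pointwise Cauchy–Schwarz `(Σcᵢeᵢ)² ≤ Σcᵢ²·Σeᵢ²`). [folklore] -/
theorem integral_weight_combination_sq_le {D : GaugeConfig 3 L SU2 → ℝ} (hDm : Measurable D) {CD : ℝ} (hDb : ∀ u, |D u| ≤ CD) (hD0 : ∀ u, 0 ≤ D u)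
    {n : ℕ} {e : Fin (n + 1) → GaugeConfig 3 L SU2 → ℝ} (he : ∀ i, IsPhys (e i)) {M : ℝ}
    (hM : ∀ i, ∫ u, D u * e i u ^ 2 ∂configMeasure SU2 L ≤ M) (c : Fin (n + 1) → ℝ) :
    ∫ u, D u * (∑ i, c i * e i u) ^ 2 ∂configMeasure SU2 L ≤ (n + 1) * M * ∑ i, c i ^ 2 := by
  have hCD : 0 ≤ CD := (abs_nonneg _).trans (hDb 1)
  choose Ce hCe using fun i => (he i).bounded
  have hcomb : IsPhys (fun u => ∑ i, c i * e i u) := isPhys_sum_mul_lat Finset.univ e he c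
  obtain ⟨Cc, hCc⟩ := hcomb.bounded
  have hiL : Integrable (fun u => D u * (∑ i, c i * e i u) ^ 2) (configMeasure SU2 L) :=
    integrable_of_measurable_abs_le _ (hDm.mul (hcomb.measurable.pow_const 2)) (C := CD * Cc ^ 2) fun u => by
      rw [abs_mul, abs_pow]; exact mul_le_mul (hDb u) (pow_le_pow_left₀ (abs_nonneg _) (hCc u) 2) (by positivity) hCD
  have hiE : ∀ i, Integrable (fun u => D u * e i u ^ 2) (configMeasure SU2 L) := fun i =>
    integrable_of_measurable_abs_le _ (hDm.mul ((he i).measurable.pow_const 2)) (C := CD * Ce i ^ 2) fun u => by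
      rw [abs_mul, abs_pow]; exact mul_le_mul (hDb u) (pow_le_pow_left₀ (abs_nonneg _) (hCe i u) 2) (by positivity) hCD
  have hiR : Integrable (fun u => (∑ i, c i ^ 2) * ∑ i, D u * e i u ^ 2) (configMeasure SU2 L) :=
    (integrable_finsetSum _ fun i _ => hiE i).const_mul _
  have hpt : ∀ u, D u * (∑ i, c i * e i u) ^ 2 ≤ (∑ i, c i ^ 2) * ∑ i, D u * e i u ^ 2 := fun u => by
    have hcs : (∑ i, c i * e i u) ^ 2 ≤ (∑ i, c i ^ 2) * ∑ i, e i u ^ 2 := Finset.sum_mul_sq_le_sq_mul_sq _ _ _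
    have := mul_le_mul_of_nonneg_left hcs (hD0 u)
    calc D u * (∑ i, c i * e i u) ^ 2 ≤ D u * ((∑ i, c i ^ 2) * ∑ i, e i u ^ 2) := this
      _ = (∑ i, c i ^ 2) * ∑ i, D u * e i u ^ 2 := by rw [Finset.mul_sum, Finset.mul_sum, Finset.mul_sum]; ring_nf
  calc ∫ u, D u * (∑ i, c i * e i u) ^ 2 ∂configMeasure SU2 L ≤ ∫ u, (∑ i, c i ^ 2) * ∑ i, D u * e i u ^ 2 ∂configMeasure SU2 L :=
        integral_mono hiL hiR hpt
    _ = (∑ i, c i ^ 2) * ∑ i, ∫ u, D u * e i u ^ 2 ∂configMeasure SU2 L := by rw [integral_const_mul, integral_finsetSum _ fun i _ => hiE i]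
    _ ≤ (∑ i, c i ^ 2) * ∑ _i : Fin (n + 1), M :=
        mul_le_mul_of_nonneg_left (Finset.sum_le_sum fun i _ => hM i) (Finset.sum_nonneg fun i _ => sq_nonneg _)
    _ = (n + 1) * M * ∑ i, c i ^ 2 := by simp; ring

/-! ## §3 ★ The two dressed moment forms on the symmetrised window -/

/-- ★ **THE DRESSED SECOND-MOMENT FORM ON THE CLUSTER SPAN** (`V`-hypothesis of `qform_dressed_le_of_cluster`).  `W` physical with `|W(u)² − 1| ≤ κ_W·orbitDist(u)²` on
`{orbitDist < δ}`, `δ ≤ 1/2`; `S = {Θ_δ ≠ 0}`; physical `eᵢ` with one-orbit second moments `∫_{orbitDist<1/2} orbitDist²·eᵢ² ≤ M`.  Then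
`∫ 𝟙_S|W²−1|·(Σcᵢeᵢ)² ≤ 8κ_W(n+1)M·Σcᵢ²`. [folklore] -/
theorem dressed_moment_form_le {W : GaugeConfig 3 L SU2 → ℝ} (hW : IsPhys W) {κW δ : ℝ} (hκW : 0 ≤ κW) (hδ : δ ≤ 1 / 2)
    (hWsq : ∀ u, orbitDist u < δ → |W u ^ 2 - 1| ≤ κW * orbitDist u ^ 2)
    {n : ℕ} {e : Fin (n + 1) → GaugeConfig 3 L SU2 → ℝ} (he : ∀ i, IsPhys (e i)) {M : ℝ}
    (hM : ∀ i, ∫ u, (if orbitDist u < 1 / 2 then orbitDist u ^ 2 else 0) * e i u ^ 2 ∂configMeasure SU2 L ≤ M) (c : Fin (n + 1) → ℝ) :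
    ∫ u, {u : GaugeConfig 3 L SU2 | twistSum (fun v => if orbitDist v < δ then (1 : ℝ) else 0) u ≠ 0}.indicator (fun u => |W u ^ 2 - 1|) u *
        (∑ i, c i * e i u) ^ 2 ∂configMeasure SU2 L ≤ 8 * κW * (n + 1) * M * ∑ i, c i ^ 2 := by
  set S : Set (GaugeConfig 3 L SU2) := {u | twistSum (fun v => if orbitDist v < δ then (1 : ℝ) else 0) u ≠ 0} with hSdef
  set D : GaugeConfig 3 L SU2 → ℝ := fun v => if orbitDist v < 1 / 2 then orbitDist v ^ 2 else 0 with hDdef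
  have hDm : Measurable D := Measurable.ite (measurableSet_lt measurable_orbitDist measurable_const) (measurable_orbitDist.pow_const 2) measurable_const
  have hD0 : ∀ v, 0 ≤ D v := fun v => by simp only [hDdef]; split_ifs <;> positivity
  have hDb : ∀ v, |D v| ≤ 1 / 4 := fun v => by
    rw [abs_of_nonneg (hD0 v)]; simp only [hDdef]
    split_ifs with h
    · nlinarith [orbitDist_nonneg v, h]
    · norm_num
  -- pointwise domination of the dressed weight on `S` by the twist-symmetrised second-moment weight
  have hpt : ∀ u, S.indicator (fun u => |W u ^ 2 - 1|) u ≤ κW * ∑ z : Fin 3 → Bool, D (TT.twist3 z u) := by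
    intro u
    have hsum0 : 0 ≤ ∑ z : Fin 3 → Bool, D (TT.twist3 z u) := Finset.sum_nonneg fun z _ => hD0 _
    by_cases hu : u ∈ S
    · rw [Set.indicator_of_mem hu]
      obtain ⟨z, hz⟩ := (twistWindow_ne_zero_iff δ u).mp hu
      have hWz : W u = W (TT.twist3 z u) := (TT.twist3_eq_of_isPhys hW z u).symm
      have h1 : |W u ^ 2 - 1| ≤ κW * orbitDist (TT.twist3 z u) ^ 2 := by rw [hWz]; exact hWsq _ hz
      have h2 : orbitDist (TT.twist3 z u) ^ 2 = D (TT.twist3 z u) := by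
        simp only [hDdef]; rw [if_pos (lt_of_lt_of_le hz hδ)]
      have h3 : D (TT.twist3 z u) ≤ ∑ z' : Fin 3 → Bool, D (TT.twist3 z' u) :=
        Finset.single_le_sum (f := fun z' : Fin 3 → Bool => D (TT.twist3 z' u)) (fun z' _ => hD0 _) (Finset.mem_univ z)
      rw [h2] at h1
      exact h1.trans (mul_le_mul_of_nonneg_left h3 hκW)
    · rw [Set.indicator_of_notMem hu]; exact mul_nonneg hκW hsum0
  -- integrate
  have hcomb : IsPhys (fun u => ∑ i, c i * e i u) := isPhys_sum_mul_lat Finset.univ e he c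
  obtain ⟨Cc, hCc⟩ := hcomb.bounded
  obtain ⟨CW, hCW⟩ := hW.bounded
  have hSm : MeasurableSet S := (twistWindow_set_props (L := L) δ).1
  have hindm : Measurable (S.indicator fun u => |W u ^ 2 - 1|) := (((hW.measurable.pow_const 2).sub measurable_const).abs).indicator hSm
  have hindb : ∀ u, |S.indicator (fun u => |W u ^ 2 - 1|) u| ≤ CW ^ 2 + 1 := fun u => by
    have h0 : |W u ^ 2 - 1| ≤ CW ^ 2 + 1 := by
      calc |W u ^ 2 - 1| ≤ |W u ^ 2| + |(1 : ℝ)| := abs_sub _ _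
        _ ≤ CW ^ 2 + 1 := by rw [abs_one, abs_pow]; nlinarith [pow_le_pow_left₀ (abs_nonneg _) (hCW u) 2]
    by_cases hu : u ∈ S
    · rw [Set.indicator_of_mem hu, abs_abs]; exact h0
    · rw [Set.indicator_of_notMem hu, abs_zero]; positivity
  have hsumm : Measurable (fun u => ∑ z : Fin 3 → Bool, D (TT.twist3 z u)) := Finset.measurable_sum _ fun z _ => hDm.comp (TT.measurable_twist3 z)
  have hsumb : ∀ u, |∑ z : Fin 3 → Bool, D (TT.twist3 z u)| ≤ 8 * (1 / 4) := fun u =>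
    (Finset.abs_sum_le_sum_abs _ _).trans (le_of_le_of_eq (Finset.sum_le_sum fun z _ => hDb _) (by norm_num))
  have hiL : Integrable (fun u => S.indicator (fun u => |W u ^ 2 - 1|) u * (∑ i, c i * e i u) ^ 2) (configMeasure SU2 L) :=
    integrable_of_measurable_abs_le _ (hindm.mul (hcomb.measurable.pow_const 2)) (C := (CW ^ 2 + 1) * Cc ^ 2) fun u => by
      rw [abs_mul, abs_pow]; exact mul_le_mul (hindb u) (pow_le_pow_left₀ (abs_nonneg _) (hCc u) 2) (by positivity) (by positivity)
  have hiR0 : Integrable (fun u => (∑ z : Fin 3 → Bool, D (TT.twist3 z u)) * (∑ i, c i * e i u) ^ 2) (configMeasure SU2 L) :=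
    integrable_of_measurable_abs_le _ (hsumm.mul (hcomb.measurable.pow_const 2)) (C := 8 * (1 / 4) * Cc ^ 2) fun u => by
      rw [abs_mul, abs_pow]; exact mul_le_mul (hsumb u) (pow_le_pow_left₀ (abs_nonneg _) (hCc u) 2) (by positivity) (by positivity)
  have hiR : Integrable (fun u => κW * ((∑ z : Fin 3 → Bool, D (TT.twist3 z u)) * (∑ i, c i * e i u) ^ 2)) (configMeasure SU2 L) :=
    hiR0.const_mul κW
  calc ∫ u, S.indicator (fun u => |W u ^ 2 - 1|) u * (∑ i, c i * e i u) ^ 2 ∂configMeasure SU2 L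
      ≤ ∫ u, κW * ((∑ z : Fin 3 → Bool, D (TT.twist3 z u)) * (∑ i, c i * e i u) ^ 2) ∂configMeasure SU2 L :=
        integral_mono hiL hiR fun u => by
          have := mul_le_mul_of_nonneg_right (hpt u) (sq_nonneg (∑ i, c i * e i u))
          linarith
    _ = κW * (8 * ∫ u, D u * (∑ i, c i * e i u) ^ 2 ∂configMeasure SU2 L) := by
        rw [integral_const_mul, integral_sum_twist_mul_sq hDm hDb hcomb]
    _ ≤ κW * (8 * ((n + 1) * M * ∑ i, c i ^ 2)) :=
        mul_le_mul_of_nonneg_left (mul_le_mul_of_nonneg_left (integral_weight_combination_sq_le hDm hDb hD0 he hM c) (by norm_num)) hκW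
    _ = 8 * κW * (n + 1) * M * ∑ i, c i ^ 2 := by ring

/-- ★ **THE OVERLAPS** (`w`-hypothesis of `qform_dressed_le_of_cluster`): under the same hypotheses and `W ≥ 0`,
`Σᵢ ‖𝟙_S(W−1)eᵢ‖² ≤ (n+1)·(κ_Wδ²)·(8κ_W(n+1)M)` — on `S`, `(W−1)² ≤ |W²−1|² ≤ κ_Wδ²·|W²−1|`. [folklore] -/
theorem dressed_overlap_le {W : GaugeConfig 3 L SU2 → ℝ} (hW : IsPhys W) (hW0 : ∀ u, 0 ≤ W u) {κW δ : ℝ} (hκW : 0 ≤ κW) (hδ : δ ≤ 1 / 2)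
    (hWsq : ∀ u, orbitDist u < δ → |W u ^ 2 - 1| ≤ κW * orbitDist u ^ 2)
    {n : ℕ} {e : Fin (n + 1) → GaugeConfig 3 L SU2 → ℝ} (he : ∀ i, IsPhys (e i)) {M : ℝ}
    (hM : ∀ i, ∫ u, (if orbitDist u < 1 / 2 then orbitDist u ^ 2 else 0) * e i u ^ 2 ∂configMeasure SU2 L ≤ M) :
    ∑ i : Fin (n + 1), l2 (fun u => {u : GaugeConfig 3 L SU2 | twistSum (fun v => if orbitDist v < δ then (1 : ℝ) else 0) u ≠ 0}.indicator 1 u * (W u - 1) * e i u)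
        (fun u => {u : GaugeConfig 3 L SU2 | twistSum (fun v => if orbitDist v < δ then (1 : ℝ) else 0) u ≠ 0}.indicator 1 u * (W u - 1) * e i u) ≤
      (n + 1) * (κW * δ ^ 2) * (8 * κW * (n + 1) * M) := by
  classical
  set S : Set (GaugeConfig 3 L SU2) := {u | twistSum (fun v => if orbitDist v < δ then (1 : ℝ) else 0) u ≠ 0} with hSdef
  set κ : ℝ := κW * δ ^ 2 with hκdef
  have hκ0 : 0 ≤ κ := by positivity
  -- on `S`: `|W² − 1| ≤ κ`
  have hSκ : ∀ u ∈ S, |W u ^ 2 - 1| ≤ κ := by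
    intro u hu
    obtain ⟨z, hz⟩ := (twistWindow_ne_zero_iff δ u).mp hu
    rw [← TT.twist3_eq_of_isPhys hW z u]
    refine (hWsq _ hz).trans (mul_le_mul_of_nonneg_left ?_ hκW)
    exact pow_le_pow_left₀ (orbitDist_nonneg _) hz.le 2
  -- each term: `‖𝟙_S(W−1)e_i‖² ≤ κ · ∫ 𝟙_S|W²−1| e_i² ≤ κ · (8κ_W(n+1)M)`
  have hterm : ∀ i : Fin (n + 1), l2 (fun u => S.indicator 1 u * (W u - 1) * e i u) (fun u => S.indicator 1 u * (W u - 1) * e i u) ≤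
      κ * (8 * κW * (n + 1) * M) := by
    intro i
    obtain ⟨Ce, hCe⟩ := (he i).bounded
    obtain ⟨CW, hCW⟩ := hW.bounded
    have hSm : MeasurableSet S := (twistWindow_set_props (L := L) δ).1
    -- the `V`-form at `c = δ_i`
    have hV := dressed_moment_form_le hW hκW hδ hWsq he hM (fun j => if j = i then (1 : ℝ) else 0)
    have hcomb : ∀ u, (∑ j, (if j = i then (1 : ℝ) else 0) * e j u) = e i u := fun u => by
      rw [Finset.sum_eq_single i (fun j _ hji => by simp [hji]) (fun h => (h (Finset.mem_univ i)).elim)]; simp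
    have hcsq : ∑ j : Fin (n + 1), (if j = i then (1 : ℝ) else 0) ^ 2 = 1 := by
      rw [Finset.sum_eq_single i (fun j _ hji => by simp [hji]) (fun h => (h (Finset.mem_univ i)).elim)]; simp
    simp only [hcomb, hcsq, mul_one] at hV
    -- pointwise: `(𝟙_S (W−1) e)² ≤ κ · 𝟙_S|W²−1| · e²`
    have hpt : ∀ u, (S.indicator 1 u * (W u - 1) * e i u) * (S.indicator 1 u * (W u - 1) * e i u) ≤
        κ * (S.indicator (fun u => |W u ^ 2 - 1|) u * e i u ^ 2) := by
      intro u
      by_cases hu : u ∈ S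
      · rw [Set.indicator_of_mem hu, Set.indicator_of_mem hu, Pi.one_apply]
        have hW1 : |W u - 1| ≤ |W u ^ 2 - 1| := by
          have e1 : W u ^ 2 - 1 = (W u - 1) * (W u + 1) := by ring
          rw [e1, abs_mul]
          have : 1 ≤ |W u + 1| := by rw [abs_of_nonneg (by linarith [hW0 u])]; linarith [hW0 u]
          nlinarith [abs_nonneg (W u - 1)]
        have h2 : (W u - 1) ^ 2 ≤ κ * |W u ^ 2 - 1| := by
          have h3 : |W u - 1| ^ 2 ≤ |W u ^ 2 - 1| ^ 2 := pow_le_pow_left₀ (abs_nonneg _) hW1 2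
          rw [sq_abs] at h3
          calc (W u - 1) ^ 2 ≤ |W u ^ 2 - 1| ^ 2 := h3
            _ = |W u ^ 2 - 1| * |W u ^ 2 - 1| := sq _
            _ ≤ κ * |W u ^ 2 - 1| := mul_le_mul_of_nonneg_right (hSκ u hu) (abs_nonneg _)
        nlinarith [h2, sq_nonneg (e i u)]
      · rw [Set.indicator_of_notMem hu, Set.indicator_of_notMem hu]; simp
    have hJm : Measurable (fun u => S.indicator (1 : GaugeConfig 3 L SU2 → ℝ) u * (W u - 1) * e i u) :=
      (((measurable_const.indicator hSm).mul (hW.measurable.sub measurable_const)).mul (he i).measurable)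
    have hJb : ∀ u, |S.indicator (1 : GaugeConfig 3 L SU2 → ℝ) u * (W u - 1) * e i u| ≤ (CW + 1) * Ce := fun u => by
      rw [abs_mul, abs_mul]
      have h1 : |S.indicator (1 : GaugeConfig 3 L SU2 → ℝ) u| ≤ 1 := by
        by_cases hu : u ∈ S
        · rw [Set.indicator_of_mem hu]; simp
        · rw [Set.indicator_of_notMem hu]; simp
      have h2 : |W u - 1| ≤ CW + 1 := (abs_sub _ _).trans (by rw [abs_one]; linarith [hCW u])
      have hCW0 : 0 ≤ CW := (abs_nonneg _).trans (hCW u)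
      calc |S.indicator (1 : GaugeConfig 3 L SU2 → ℝ) u| * |W u - 1| * |e i u| ≤ 1 * (CW + 1) * Ce := by
            refine mul_le_mul (mul_le_mul h1 h2 (abs_nonneg _) zero_le_one) (hCe u) (abs_nonneg _) (by positivity)
        _ = (CW + 1) * Ce := by ring
    have hindm : Measurable (S.indicator fun u => |W u ^ 2 - 1|) := (((hW.measurable.pow_const 2).sub measurable_const).abs).indicator hSm
    have hindb : ∀ u, |S.indicator (fun u => |W u ^ 2 - 1|) u| ≤ κ := fun u => by
      by_cases hu : u ∈ S
      · rw [Set.indicator_of_mem hu, abs_abs]; exact hSκ u hu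
      · rw [Set.indicator_of_notMem hu, abs_zero]; exact hκ0
    have hiJ : Integrable (fun u => (S.indicator 1 u * (W u - 1) * e i u) * (S.indicator 1 u * (W u - 1) * e i u)) (configMeasure SU2 L) :=
      integrable_of_measurable_abs_le _ (hJm.mul hJm) (C := (CW + 1) * Ce * ((CW + 1) * Ce)) fun u => by
        rw [abs_mul]; exact mul_le_mul (hJb u) (hJb u) (abs_nonneg _) ((abs_nonneg _).trans (hJb u))
    have hiI : Integrable (fun u => S.indicator (fun u => |W u ^ 2 - 1|) u * e i u ^ 2) (configMeasure SU2 L) :=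
      integrable_of_measurable_abs_le _ (hindm.mul ((he i).measurable.pow_const 2)) (C := κ * Ce ^ 2) fun u => by
        rw [abs_mul, abs_pow]; exact mul_le_mul (hindb u) (pow_le_pow_left₀ (abs_nonneg _) (hCe u) 2) (by positivity) hκ0
    unfold l2
    calc ∫ u, (S.indicator 1 u * (W u - 1) * e i u) * (S.indicator 1 u * (W u - 1) * e i u) ∂configMeasure SU2 L
        ≤ ∫ u, κ * (S.indicator (fun u => |W u ^ 2 - 1|) u * e i u ^ 2) ∂configMeasure SU2 L :=
          integral_mono hiJ (hiI.const_mul κ) hpt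
      _ = κ * ∫ u, S.indicator (fun u => |W u ^ 2 - 1|) u * e i u ^ 2 ∂configMeasure SU2 L := integral_const_mul _ _
      _ ≤ κ * (8 * κW * (n + 1) * M) := mul_le_mul_of_nonneg_left hV hκ0
  calc ∑ i : Fin (n + 1), l2 (fun u => S.indicator 1 u * (W u - 1) * e i u) (fun u => S.indicator 1 u * (W u - 1) * e i u)
      ≤ ∑ _i : Fin (n + 1), κ * (8 * κW * (n + 1) * M) := Finset.sum_le_sum fun i _ => hterm i
    _ = (n + 1) * (κW * δ ^ 2) * (8 * κW * (n + 1) * M) := by simp [hκdef]; ring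

end Summit.QuantumFields.YangMills.Theorems.FemtoTransferGap.RateTube

end
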